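import Summits.Ventures.Crystal3D.Bulk.TwinJunctionAxes
import HarnessLib

/-!
# A twin junction: close-packed shells do not see stacking axes (W-2G, kernel part)

HONEST FRAMING. Part of the venture `Summits/Ventures/Crystal3D` (cell `pub-crystal3d`, phase 2;
mathematics and Lean text by seat theory-2 (g8), from the exact integer witness of theory-2 (g7),
`HOME/phase2/theory2/glue/twinpair/minwitness_coords.txt`). A NEGATIVE / scope file for the fixed
theorem wording (GLUE-STATUS.md §3): it certifies nothing about `−0.63`, moves no number, and is
not used by `BulkCrystallization3D`.
Filed by seat p1 (g8) per lead g7 RULING #60 (g7) from theory-2 (g8)'s scratch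
`HOME/lean/glue/TwinJunctionWitness.lean` (sha16 `1aca1caea487ddcc`): statements and proofs byte for
byte, docstrings added, the generic part (definitions `IsContactConnected` / `hcpAxisVec` / `HasHexAxis`
/ `IsUniaxial`, the pattern lemma, integer-model plumbing, `flipInt` / `coordFlip`) split off as
`Bulk/TwinJunctionAxes.lean` for the tree's 400-line rule.

WHAT IT PROVES (kernel arithmetic on an explicit `26`-ball integer model at scale `1/√18`, plus one
pattern lemma). In the unit packing `twinConfig` (three closed contact shells of an fcc crystal
carrying two coherent `{111}` twin lamellae of DIFFERENT orientation that cross at one ball):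
* ball `0` has an ANTICUBOCTAHEDRAL (hcp) contact shell, literally `2 · hcpKissingPattern`
  (hexagonal mirror plane normal to `(1,1,1)`);
* ball `1` has a CUBOCTAHEDRAL (fcc) contact shell, literally `2 · fccKissingPattern`;
* ball `2` has an anticuboctahedral contact shell, the image of `2 · hcpKissingPattern` under the
  coordinate reflection `x₂ ↦ −x₂` (mirror plane normal to `(1,1,−1)`);
* `0 — 1 — 2` is a contact path, so `G = {0, 1, 2}` is contact-connected and every member of `G`
  is close-packed-shelled (`IsClosePackedShell`);
* **`not_isUniaxial_twinConfig`**: there is NO common axis `n` such that every anticuboctahedral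
  member of `G` has hexagonal mirror plane normal to `± n` — because (pattern lemma
  `inner_axis_eq_zero_of_neg_mem`) under ANY congruence `A` placing the hcp pattern onto a shell,
  the image of the pattern axis is orthogonal to every shell vector whose antipode is also a shell
  vector, and the two hexagons here span non-parallel planes.
Packaged: **`twinJunctionWitness`** — a finite unit packing with a non-empty contact-connected
cluster of close-packed-shelled balls that is not uni-axial.

MEANING for the wording (GLUE-STATUS §3 W-2G / W-2b): contact-maximisation plus close-packed first
shells cannot control stacking AXES — grains of different hexagonal axis are welded seamlessly
through close-packed balls (coherent twins are contact-neutral). Hence the uni-axial hypothesis of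
the grain lemma W-2b (`UniaxialGrainRigidity`, theory-2's statement file) is a genuine restriction,
and no «⊂ one Barlow packing / bounded number of Barlow grains» clause can be appended to the
bulk theorem on the strength of close-packed shells alone. (That a fragment of ONE Barlow stacking
is uni-axial on its anticuboctahedral members — which would turn this file into a refutation of the
naive grain lemma `NaiveGrainRigidity` verbatim — is standard layer geometry, NOT proved here.)
-/

noncomputable section

open scoped BigOperators InnerProductSpace
open Finset

namespace Summit.Ventures.Crystal3D

open Literature.Geometry.DiscreteGeometry (fccKissingPattern hcpKissingPattern fccInt hcpInt intVec
  intVec_apply intVec_sub intVec_injective sqNormInt scaledPattern IsArrangedIn isArrangedIn_self)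
open Literature.Barriers.AtomisticToContinuum (intConfig)

variable {N : ℕ}

/-! ## The 26-ball twin junction -/

/-- The `26` sites (integer model at scale `1/√18`, contact at squared distance `18`): three
closed contact shells of an fcc crystal (nearest-neighbour star `3 · fccInt`) twinned coherently
across the plane `x₀ + x₁ + x₂ = 0` through site `0` and across the plane `x₀ + x₁ − x₂ = −6`
through site `2`; label `0` = hcp-shelled ball with axis `(1,1,1)` at the origin, `1` = fcc-shelled
ball at `(0,3,3)`, `2` = hcp-shelled ball with axis `(1,1,−1)` at `(0,0,6)`. -/
def twinInt : Fin 26 → Fin 3 → ℤ :=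
  ![![0, 0, 0], ![0, 3, 3], ![0, 0, 6], ![-4, -1, -1], ![-4, -1, 7], ![-3, 0, 3], ![-3, 3, 0],
    ![-3, 3, 6], ![-3, 6, 3], ![-1, -4, -1], ![-1, -4, 7], ![-1, -1, -4], ![-1, -1, 10],
    ![0, -3, 3], ![0, 3, -3], ![0, 3, 9], ![0, 6, 0], ![0, 6, 6], ![3, -3, 0], ![3, -3, 6],
    ![3, 0, -3], ![3, 0, 3], ![3, 0, 9], ![3, 3, 0], ![3, 3, 6], ![3, 6, 3]]

/-- The twin-junction configuration: `twinInt` at scale `1/√18`. -/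
def twinConfig : Fin 26 → EuclideanSpace ℝ (Fin 3) :=
  intConfig twinInt (1 / Real.sqrt (18 : ℕ))

/-- Distinct sites are at squared distance `≥ 18` (kernel check over all pairs). -/
theorem sep_twinInt : ∀ i j : Fin 26, i ≠ j → (18 : ℤ) ≤ sqNormInt (twinInt i - twinInt j) := by
  decide +kernel

/-- `twinConfig` is a packing of diameter-`1` balls. -/
theorem isUnitPacking_twinConfig : IsUnitPacking twinConfig :=
  isUnitPacking_intConfig _ (by norm_num) sep_twinInt

/-- The integer contact shell of site `0` is the hcp star `hcpInt` verbatim (kernel check). -/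
theorem image_shell_twinInt_zero :
    (univ.filter fun j : Fin 26 => j ≠ 0 ∧ sqNormInt (twinInt 0 - twinInt j) = (18 : ℕ)).image
        (fun j => twinInt j - twinInt 0) = hcpInt := by
  decide +kernel

/-- The integer contact shell of site `1` is the fcc star `3 · fccInt` (kernel check). -/
theorem image_shell_twinInt_one :
    (univ.filter fun j : Fin 26 => j ≠ 1 ∧ sqNormInt (twinInt 1 - twinInt j) = (18 : ℕ)).image
        (fun j => twinInt j - twinInt 1) = fccInt.image fun t => 3 • t := by
  decide +kernel


/-- The integer contact shell of site `2` is the reflected hcp star `flipInt '' hcpInt` (kernel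
check). -/
theorem image_shell_twinInt_two :
    (univ.filter fun j : Fin 26 => j ≠ 2 ∧ sqNormInt (twinInt 2 - twinInt j) = (18 : ℕ)).image
        (fun j => twinInt j - twinInt 2) = hcpInt.image flipInt := by
  decide +kernel

/-- **Ball `0`: the contact shell is the doubled hcp pattern** `2 · hcpKissingPattern`. -/
theorem contactShell_twinConfig_zero :
    contactShell twinConfig 0 =
      (fun p => (2 : ℝ) • p) '' (hcpKissingPattern : Set (EuclideanSpace ℝ (Fin 3))) := by
  rw [twinConfig, contactShell_intConfig _ (by norm_num), image_shell_twinInt_zero, hcpKissingPattern,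
    scaledPattern, coe_image, Set.image_image]

/-- **Ball `1`: the contact shell is the doubled fcc pattern** `2 · fccKissingPattern`. -/
theorem contactShell_twinConfig_one :
    contactShell twinConfig 1 =
      (fun p => (2 : ℝ) • p) '' (fccKissingPattern : Set (EuclideanSpace ℝ (Fin 3))) := by
  rw [twinConfig, contactShell_intConfig _ (by norm_num), image_shell_twinInt_one, fccKissingPattern,
    scaledPattern, coe_image, coe_image, Set.image_image, Set.image_image]
  refine Set.image_congr' fun t => ?_
  simp only [intVec_three_smul, smul_smul]
  congr 1
  rw [sqrt_eighteen_inv_mul_three]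


/-- Ball `0` has hexagonal axis `(1,1,1)`. -/
theorem hasHexAxis_twinConfig_zero : HasHexAxis twinConfig 0 hcpAxisVec :=
  ⟨LinearIsometry.id, by simpa using contactShell_twinConfig_zero, Or.inl rfl⟩

/-- **Ball `2`: the contact shell is the REFLECTED doubled hcp pattern**
`2 · coordFlip (hcpKissingPattern)` (hexagonal mirror plane normal to `(1,1,−1)`). -/
theorem contactShell_twinConfig_two :
    contactShell twinConfig 2 =
      (fun p => (2 : ℝ) • coordFlip.toLinearIsometry p) ''
        (hcpKissingPattern : Set (EuclideanSpace ℝ (Fin 3))) := by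
  rw [twinConfig, contactShell_intConfig _ (by norm_num), image_shell_twinInt_two, hcpKissingPattern,
    scaledPattern, coe_image, coe_image, Set.image_image, Set.image_image]
  refine Set.image_congr' fun t => ?_
  simp only [LinearIsometryEquiv.coe_toLinearIsometry, map_smul, coordFlip_intVec]

/-- Ball `2` has hexagonal axis `(1,1,−1)`. -/
theorem hasHexAxis_twinConfig_two : HasHexAxis twinConfig 2 (intVec ![1, 1, -1]) :=
  ⟨coordFlip.toLinearIsometry, contactShell_twinConfig_two,
    Or.inl (by rw [LinearIsometryEquiv.coe_toLinearIsometry, coordFlip_hcpAxisVec])⟩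

/-- Ball `0` is close-packed-shelled (hcp). -/
theorem isArrangedIn_twinConfig_zero : IsArrangedIn (contactShell twinConfig 0) hcpKissingPattern := by
  rw [contactShell_twinConfig_zero]; exact isArrangedIn_self _

/-- Ball `1` is close-packed-shelled (fcc). -/
theorem isArrangedIn_twinConfig_one : IsArrangedIn (contactShell twinConfig 1) fccKissingPattern := by
  rw [contactShell_twinConfig_one]; exact isArrangedIn_self _

/-- Ball `2` is close-packed-shelled (hcp, reflected placement). -/
theorem isArrangedIn_twinConfig_two : IsArrangedIn (contactShell twinConfig 2) hcpKissingPattern := by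
  rw [contactShell_twinConfig_two]; exact ⟨coordFlip.toLinearIsometry, rfl⟩

/-- Ball `0` is close-packed-shelled. -/
theorem isClosePackedShell_twinConfig_zero : IsClosePackedShell twinConfig 0 :=
  Or.inr isArrangedIn_twinConfig_zero

/-- Ball `1` is close-packed-shelled. -/
theorem isClosePackedShell_twinConfig_one : IsClosePackedShell twinConfig 1 :=
  Or.inl isArrangedIn_twinConfig_one

/-- Ball `2` is close-packed-shelled. -/
theorem isClosePackedShell_twinConfig_two : IsClosePackedShell twinConfig 2 :=
  Or.inr isArrangedIn_twinConfig_two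

/-! ## The cluster `G = {0, 1, 2}`: contact path `0 — 1 — 2` -/

/-- The junction cluster: the two hcp-shelled balls and the fcc-shelled ball between them. -/
def twinCluster : Finset (Fin 26) := {0, 1, 2}

/-- Contact neighbours of `twinConfig` from an integer squared-distance check. -/
theorem mem_contactNeighbors_twinConfig {i j : Fin 26} (hij : j ≠ i)
    (h : sqNormInt (twinInt i - twinInt j) = (18 : ℕ)) : j ∈ contactNeighbors twinConfig i :=
  (mem_contactNeighbors_intConfig _ (by norm_num)).2 ⟨hij, h⟩

/-- `1` touches `0`. -/
theorem one_mem_contactNeighbors_zero : (1 : Fin 26) ∈ contactNeighbors twinConfig 0 :=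
  mem_contactNeighbors_twinConfig (by decide) (by decide +kernel)

/-- `0` touches `1`. -/
theorem zero_mem_contactNeighbors_one : (0 : Fin 26) ∈ contactNeighbors twinConfig 1 :=
  mem_contactNeighbors_twinConfig (by decide) (by decide +kernel)

/-- `2` touches `1`. -/
theorem two_mem_contactNeighbors_one : (2 : Fin 26) ∈ contactNeighbors twinConfig 1 :=
  mem_contactNeighbors_twinConfig (by decide) (by decide +kernel)

/-- `1` touches `2`. -/
theorem one_mem_contactNeighbors_two : (1 : Fin 26) ∈ contactNeighbors twinConfig 2 :=
  mem_contactNeighbors_twinConfig (by decide) (by decide +kernel)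

/-- `G = {0,1,2}` is contact-connected (path `0 — 1 — 2`). -/
theorem isContactConnected_twinCluster : IsContactConnected twinConfig twinCluster := by
  have m0 : (0 : Fin 26) ∈ twinCluster := by simp [twinCluster]
  have m1 : (1 : Fin 26) ∈ twinCluster := by simp [twinCluster]
  have m2 : (2 : Fin 26) ∈ twinCluster := by simp [twinCluster]
  let R : Fin 26 → Fin 26 → Prop := fun a b =>
    a ∈ twinCluster ∧ b ∈ twinCluster ∧ b ∈ contactNeighbors twinConfig a
  have h01 : R 0 1 := ⟨m0, m1, one_mem_contactNeighbors_zero⟩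
  have h10 : R 1 0 := ⟨m1, m0, zero_mem_contactNeighbors_one⟩
  have h12 : R 1 2 := ⟨m1, m2, two_mem_contactNeighbors_one⟩
  have h21 : R 2 1 := ⟨m2, m1, one_mem_contactNeighbors_two⟩
  intro i hi j hj
  simp only [twinCluster, mem_insert, mem_singleton] at hi hj
  rcases hi with rfl | rfl | rfl <;> rcases hj with rfl | rfl | rfl
  · exact Relation.ReflTransGen.refl
  · exact Relation.ReflTransGen.single h01
  · exact (Relation.ReflTransGen.single h01).trans (Relation.ReflTransGen.single h12)
  · exact Relation.ReflTransGen.single h10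
  · exact Relation.ReflTransGen.refl
  · exact Relation.ReflTransGen.single h12
  · exact (Relation.ReflTransGen.single h21).trans (Relation.ReflTransGen.single h10)
  · exact Relation.ReflTransGen.single h21
  · exact Relation.ReflTransGen.refl

/-- Every member of `G` has a close-packed shell. -/
theorem isClosePackedShell_of_mem_twinCluster :
    ∀ i ∈ twinCluster, IsClosePackedShell twinConfig i := by
  intro i hi
  simp only [twinCluster, mem_insert, mem_singleton] at hi
  rcases hi with rfl | rfl | rfl
  · exact isClosePackedShell_twinConfig_zero
  · exact isClosePackedShell_twinConfig_one
  · exact isClosePackedShell_twinConfig_two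

/-! ## No common axis -/

/-- From ball `0`: a common axis `n` is orthogonal to the `(1,1,1)`-hexagon. -/
theorem inner_eq_zero_of_hasHexAxis_zero {n : EuclideanSpace ℝ (Fin 3)}
    (h : HasHexAxis twinConfig 0 n) :
    ∀ t ∈ hcpInt, -t ∈ hcpInt → ⟪n, intVec t⟫_ℝ = 0 := by
  obtain ⟨A, hS, hax⟩ := h
  intro t ht hnt
  set s : EuclideanSpace ℝ (Fin 3) := (2 : ℝ) • ((Real.sqrt ((18 : ℕ) : ℝ))⁻¹ • intVec t) with hs_def
  have hs : s ∈ contactShell twinConfig 0 := by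
    rw [contactShell_twinConfig_zero, hcpKissingPattern, scaledPattern, coe_image, Set.image_image]
    exact ⟨t, by simpa using ht, rfl⟩
  have hns : -s ∈ contactShell twinConfig 0 := by
    rw [contactShell_twinConfig_zero, hcpKissingPattern, scaledPattern, coe_image, Set.image_image]
    refine ⟨-t, by simpa using hnt, ?_⟩
    simp only [hs_def, intVec_neg, smul_neg]
  have key := inner_axis_eq_zero_of_neg_mem hS hs hns
  have hn : ⟪n, s⟫_ℝ = 0 := by
    rcases hax with h | h
    · rw [← h]; exact key
    · have : n = -(A hcpAxisVec) := by rw [h, neg_neg]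
      rw [this, inner_neg_left, key, neg_zero]
  have h18 : (Real.sqrt ((18 : ℕ) : ℝ))⁻¹ ≠ 0 := by positivity
  simpa [hs_def, inner_smul_right, h18] using hn

/-- From ball `2`: a common axis `n` is orthogonal to the `(1,1,−1)`-hexagon. -/
theorem inner_eq_zero_of_hasHexAxis_two {n : EuclideanSpace ℝ (Fin 3)}
    (h : HasHexAxis twinConfig 2 n) :
    ∀ t ∈ hcpInt, -t ∈ hcpInt → ⟪n, intVec (flipInt t)⟫_ℝ = 0 := by
  obtain ⟨A, hS, hax⟩ := h
  intro t ht hnt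
  set s : EuclideanSpace ℝ (Fin 3) :=
    (2 : ℝ) • ((Real.sqrt ((18 : ℕ) : ℝ))⁻¹ • intVec (flipInt t)) with hs_def
  have hflip : ∀ u : Fin 3 → ℤ, (2 : ℝ) • coordFlip.toLinearIsometry
      ((Real.sqrt ((18 : ℕ) : ℝ))⁻¹ • intVec u) =
        (2 : ℝ) • ((Real.sqrt ((18 : ℕ) : ℝ))⁻¹ • intVec (flipInt u)) := fun u => by
    simp only [LinearIsometryEquiv.coe_toLinearIsometry, map_smul, coordFlip_intVec]
  have hs : s ∈ contactShell twinConfig 2 := by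
    rw [contactShell_twinConfig_two, hcpKissingPattern, scaledPattern, coe_image, Set.image_image]
    exact ⟨t, by simpa using ht, hflip t⟩
  have hns : -s ∈ contactShell twinConfig 2 := by
    rw [contactShell_twinConfig_two, hcpKissingPattern, scaledPattern, coe_image, Set.image_image]
    refine ⟨-t, by simpa using hnt, ?_⟩
    beta_reduce
    rw [hflip (-t)]
    have : flipInt (-t) = -flipInt t := by
      ext j; fin_cases j <;> simp [flipInt]
    simp only [hs_def, this, intVec_neg, smul_neg]
  have key := inner_axis_eq_zero_of_neg_mem hS hs hns
  have hn : ⟪n, s⟫_ℝ = 0 := by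
    rcases hax with h | h
    · rw [← h]; exact key
    · have : n = -(A hcpAxisVec) := by rw [h, neg_neg]
      rw [this, inner_neg_left, key, neg_zero]
  have h18 : (Real.sqrt ((18 : ℕ) : ℝ))⁻¹ ≠ 0 := by positivity
  simpa [hs_def, inner_smul_right, h18] using hn

/-- **The twin junction is not uni-axial**: no single axis serves both hcp-shelled balls. -/
theorem not_isUniaxial_twinConfig : ¬ IsUniaxial twinConfig twinCluster := by
  rintro ⟨n, hn⟩
  have h0 := hn 0 (by simp [twinCluster]) isArrangedIn_twinConfig_zero
  have h2 := hn 2 (by simp [twinCluster]) isArrangedIn_twinConfig_two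
  have e1 := inner_eq_zero_of_hasHexAxis_zero h0 ![3, -3, 0] (by decide) (by decide)
  have e2 := inner_eq_zero_of_hasHexAxis_zero h0 ![3, 0, -3] (by decide) (by decide)
  have e3 := inner_eq_zero_of_hasHexAxis_two h2 ![3, 0, -3] (by decide) (by decide)
  rw [inner_intVec_right] at e1 e2 e3
  simp [flipInt] at e1 e2 e3
  have hn0 : n = 0 := by
    ext j
    fin_cases j <;> simp <;> linarith
  -- the axis image `A hcpAxisVec = ± n = 0` forces `hcpAxisVec = 0`
  obtain ⟨A, -, hax⟩ := h0
  have hA : A hcpAxisVec = 0 := by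
    rcases hax with h | h <;> rw [h, hn0] ; simp
  have hv : hcpAxisVec = 0 := A.injective (by rw [hA, map_zero])
  have := congrArg (fun v : EuclideanSpace ℝ (Fin 3) => v 0) hv
  simp [hcpAxisVec, intVec] at this

/-- **The twin-junction witness (packaged).** A finite unit packing with a non-empty,
contact-connected cluster of close-packed-shelled balls that is NOT uni-axial: two
anticuboctahedral shells with non-parallel hexagonal mirror planes joined through one
cuboctahedral shell. -/
theorem twinJunctionWitness :
    ∃ (N : ℕ) (x : Fin N → EuclideanSpace ℝ (Fin 3)) (G : Finset (Fin N)),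
      IsUnitPacking x ∧ G.Nonempty ∧ IsContactConnected x G ∧
        (∀ i ∈ G, IsClosePackedShell x i) ∧ ¬ IsUniaxial x G :=
  ⟨26, twinConfig, twinCluster, isUnitPacking_twinConfig, ⟨0, by simp [twinCluster]⟩,
    isContactConnected_twinCluster, isClosePackedShell_of_mem_twinCluster,
    not_isUniaxial_twinConfig⟩


end Summit.Ventures.Crystal3D

end
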